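import Summits.BirchSwinnertonDyer.BirchSwinnertonDyer.Theses.PrintX10b
import Summits.BirchSwinnertonDyer.BirchSwinnertonDyer.Theorems.PrintX10bAnalyticMuZeroX10bStubVasersteinAway
import Summits.BirchSwinnertonDyer.BirchSwinnertonDyer.Theorems.PrintX10bAnalyticMuZeroX10bStubTheoremBOfVasersteinAway
import Summits.BirchSwinnertonDyer.BirchSwinnertonDyer.Theorems.TheoremBStub2X10b
import Summits.BirchSwinnertonDyer.BirchSwinnertonDyer.Theorems.PrintX10bAnalyticMuZeroX10bStubUnitMeasureOfNonconstancy
import Summits.BirchSwinnertonDyer.BirchSwinnertonDyer.Theorems.PrintX10bAnalyticMuZeroX10bStubMuAnZeroOfUnitMeasure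
import Summits.BirchSwinnertonDyer.Rank1Residual.X10.ClassX10bLeaf
import Summits.BirchSwinnertonDyer.Rank1Residual.X10.LeafDischargeX10b
import HarnessLib

/-!
# LINE `theoremB-x10b` CLOSED: `PrintX10b.AnalyticMuZeroX10b` (crux stmt-BirchSwinnertonDyer-20682) by name

Cell bsd-f3-mu, lead prover p1; registered skeleton sha16 41c1930e4741df0b (planner of record -imc g7, strategy -an
g3–g5, MEMO-an §12–§13).  The five registered stubs are tree theorems, imported here BY NAME:
* 1a `stub_vasersteinAway` — Vaserstein 1972 + Bass–Milnor–Serre I.3.6 at `A = ℤ[1/m]`: `G(eA, A) ≤ E(eA, A)` (PROVED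
  in the tree: port of the `𝓞_K` road to `Localization.Away` by bsd-print-x8 ty2 g7, p570731–p575156, with BMS 3.6 over
  `ℤ[1/m]` via quadratic reciprocity p574472; wrapper p575575);
* 1b `stub_theoremB_of_vasersteinAway` — THEOREM B: the cyclotomic winding classes span `pr Γ_H(N)` for every level
  `N` and prime `p ∤ N` (`ConjSpanGenAllLevels`, -an g5 / x8 p4; wrapper p572175);
* 2 `stub_nonconstancy_of_theoremB` — AN-9: non-constancy of `x ↦ [x]⁺ mod p` on `ℤ[1/p]` for odd good `p`, `E[p]`
  irreducible (x8 p1 `PrintX8VerticalStevensIrreducible`; wrapper p570739);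
* 3a `stub_unitMeasure_of_nonconstancy` — a unit value of the Mazur–Swinnerton-Dyer measure at `p = 3` (-an g5
  `CollapseThree`; p572034);
* 3b `stub_muAnZero_of_unitMeasure` — a unit coefficient of `L_3(f, α)` (x9 p2; p570705).
The composition below is the registered one, verbatim; its type is LITERALLY the route decl
`Summit.BirchSwinnertonDyer.BirchSwinnertonDyer.Theses.PrintX10b.AnalyticMuZeroX10b` (`:= X10.AnalyticMuZeroOnClassX10b`:
for every X10b pair `(E, 3)` and every newform `f` of `E`, some coefficient of `L_3(f, α_E)` is a 3-adic unit — Greenberg's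
analytic `μ = 0` at `3` on class X10b).  No named fact, no hypothesis.  BSD itself is NOT proved by this file: it discharges
the binder `hA` of `X10.bsdpOnClassX10b_of_facts` (rung W-ALL/10), whose other binders are published facts + the Schneider rider.
-/

namespace Summit.BirchSwinnertonDyer.BirchSwinnertonDyer.Cruxes.AnalyticMuZeroX10b.TheoremB

-- `Summit.<Summit>.<Sub>.…` with Summit = Sub (D-0017): the linter flags it by design
set_option linter.dupNamespace false

open scoped Classical
open CongruenceSubgroup WeierstrassCurve
open Literature.NumberTheory.EllipticCurves
open Literature.NumberTheory.EllipticCurves.ModularForms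
open Literature.NumberTheory.EllipticCurves.Rank1Residual
open Summit.BirchSwinnertonDyer.Rank1Residual.X10

/-- **`PrintX10b.AnalyticMuZeroX10b` holds** (crux stmt-BirchSwinnertonDyer-20682 of route PrintX10b, by name): Greenberg's
analytic `μ₃ = 0` on class X10b — for every X10b pair `(W, 3)` (3 good ordinary, `E[3]` irreducible, mod-3 image not
surjective) and every newform `f` of `W`, some coefficient of `L_3(f, α_W)` is a 3-adic unit.  Composition of the five
registered stubs of LINE `theoremB-x10b` (skeleton sha16 41c1930e4741df0b): (V) → THEOREM B → AN-9 non-constancy → unit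
measure value at 3 → unit coefficient. [folklore] -/
theorem AnalyticMuZeroX10b_of :
    Summit.BirchSwinnertonDyer.BirchSwinnertonDyer.Theses.PrintX10b.AnalyticMuZeroX10b := by
  intro W _ _ p _ N _ f hX _hns hf
  obtain ⟨rfl, -⟩ := id hX
  exact stub_muAnZero_of_unitMeasure W f hX.isOrdinaryAt_three hf hX.irr_three
    (stub_unitMeasure_of_nonconstancy W f hX.isOrdinaryAt_three hf hX.irr_three
      (stub_nonconstancy_of_theoremB (stub_theoremB_of_vasersteinAway stub_vasersteinAway) W 3 (by decide)
        hX.isOrdinaryAt_three.1 hX.irr_three))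

end Summit.BirchSwinnertonDyer.BirchSwinnertonDyer.Cruxes.AnalyticMuZeroX10b.TheoremB
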